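import Literature.AnabelianGeometry.EtaleTheta.Discharge.Sec3Cor38iiiOfRlfWeak
import HarnessLib

/-!
# [EtTh] Cor. 3.8 (iii), pre-steps, for tempered Frobenioids over THE `ℝ`-realified divisor monoids of the WEAK
# vocabulary (`ofRlfRWeak`, monoid type `Λ = ℝ`): the Def. 3.1 / 3.6 (iii) data axioms DISCHARGED and the
# corollary ASSEMBLED — the `Λ = ℝ` twin of `Sec3Cor38iiiOfRlfWeak.lean`

Mochizuki, *The étale theta function …*, Publ. RIMS **45** (2009), Def. 3.1 (i) p.70, Def. 3.6 (i)–(iii) pp.76–77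
("`Λ ∈ {ℤ, ℚ, ℝ}` … `B₀^ℝ := ℝ·Φ₀^birat`, `F₀^ℝ := ℝ·Φ₀^cnst`"), Cor. 3.8 (iii) pp.80–82
[cite: MochizukiEtTh2009, Cor 3.8 p.81].

abc-iut cell, layer L2, node `EtTh:Cor3.8(iii)`, seat abc-iut-L2-d2 (gen 4); proof-only `Λ = ℝ` twin of this seat's
(H) file `Sec3Cor38iiiOfRlfWeak.lean` (`Λ = ℤ`).  abc-iut-L6-t12's constructor `ofRlfRWeak dm hpf` (Def. 3.6 (i) for
`Λ = ℝ` over `treeMonoidVocabWeak`) has THE SAME `Φ₀^ℝ`, `Φ₀ → Φ₀^ℝ`, `ℝ·Φ₀^cnst` and non-cuspidal/cuspidal parts as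
`ofRlfZWeak dm hpf` (`ofRlfRWeak_toR`, `ofRlfRWeak_cnstR`, `ofRlfRWeak_ncspR`, `ofRlfRWeak_cspR`, all `rfl`); only
`B₀^ℝ = ℝ·Φ₀^birat` and `F₀^ℝ` differ, and they do not enter Cor. 3.8 (iii).  Hence every data lemma of the `Λ = ℤ`
file transfers verbatim (`…_weakR`), and the assembly runs through this seat's vocabulary-generic
`Cor38Hyp.cor38_iii_of_isFrobenioid_weak` (`Sec3Cor38iiiOfIsFrobenioidWeak.lean`):

* §1 (`TemperedFrobenioid … (ofRlfRWeak dm hpf) D VD`): `eq_one_of_isNonCuspidal_of_isCuspidal_weakR` (`hDa`),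
  `isNonCuspidal_of_precsim_weakR` / `isCuspidal_of_precsim_weakR`, `…_iff_primaries_of_noPhantom_weakR` (`hDn`/`hDc`
  from (R3)), `noPhantom_of_countable_weakR` ((R3) from countability), `isNonCuspidal_of_isBaseFieldTheoreticDiv_weakR`
  (`hD1` from the `Φ₀`-datum `hcn`);
* §2: `cor38_iii_ofRlfRWeak` (modulo the [FrdI] transports by name, `hD1`, (R3)),
  `cor38_iii_ofRlfRWeak_of_isFrobenioid` (the [FrdI] rows Thm. 3.4 (ii)/(iii), 3.7 (i)(ii), 4.2 (i) DISCHARGED),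
  `…_of_isFrobenioid_of_countable`, `…_of_isFrobenioid_of_countable_of_cnst`, and
  **`cor38_iii_ofRlfRWeak_of_isFrobenioid_of_countable_of_prop34Const` — [EtTh] Cor. 3.8 (iii), first clause, for
  tempered Frobenioids of monoid type `ℝ` over the weak data, modulo ONLY `IsFrobenioid` ([FrdI] Thm. 5.2 (ii)),
  countability of the primes of the `Φ_i(A)` (G-L2d2-4) and abc-iut-L2-t3's `DivisorMonoids.Prop34Const`**.

Theorems only.  HONEST FRAMING: classical theory of tempered Frobenioids; nothing here bears on [IUTchIII] Cor. 3.12.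
-/

namespace Literature.AnabelianGeometry.EtaleTheta

open CategoryTheory Opposite Literature.AlgebraicGeometry.Frobenioids

universe u₀ v₀ u v w

/-! ### Tempered Frobenioids over `ofRlfRWeak`: the data axioms of `cor38_iii_of` -/

namespace TemperedFrobenioid

variable {D₀ : Type u₀} [Category.{v₀} D₀] {dm : DivisorMonoids.{u₀, v₀, w} D₀}
  {hpf : ∀ Y : D₀ᵒᵖ, IsPerfFactorialCof (dm.Φ₀.obj Y)}
  {D : Type u} [Category.{v} D] {VD : FrdICatStub.{u, v, w} D}

/-- Unfolding: over `ofRlfRWeak`, `x ∈ Φ(A)` is non-cuspidal iff its support (in `Φ₀(Y_A)^rlf_factor`)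
consists of non-cuspidal primes. [cite: MochizukiEtTh2009, Def 3.6 p.77] -/
theorem isNonCuspidal_iff_supp_weakR
    (C : TemperedFrobenioid (RealifiedDivisorMonoids.ofRlfRWeak dm hpf) D VD) {A : Dᵒᵖ} (x : C.Φ.carrier A) :
    C.IsNonCuspidal x ↔
      supp ((hpf (C.baseOp A)).weak.realification.subtype (x : C.ΦRlog.obj A)) ⊆
        RealifiedDivisorMonoids.toRSuppOfWeak dm hpf (C.baseOp A) (dm.ncsp₀ (C.baseOp A)) :=
  Iff.rfl

/-- Unfolding: over `ofRlfRWeak`, `x ∈ Φ(A)` is cuspidal iff its support consists of cuspidal primes.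
[cite: MochizukiEtTh2009, Def 3.6 p.77] -/
theorem isCuspidal_iff_supp_weakR
    (C : TemperedFrobenioid (RealifiedDivisorMonoids.ofRlfRWeak dm hpf) D VD) {A : Dᵒᵖ} (x : C.Φ.carrier A) :
    C.IsCuspidal x ↔
      supp ((hpf (C.baseOp A)).weak.realification.subtype (x : C.ΦRlog.obj A)) ⊆
        RealifiedDivisorMonoids.toRSuppOfWeak dm hpf (C.baseOp A) (dm.csp₀ (C.baseOp A)) :=
  Iff.rfl

/-- **(`hDa`) An element of `Φ(A)` that is both non-cuspidal and cuspidal is trivial** — DISCHARGED over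
`ofRlfRWeak` (same non-cuspidal/cuspidal parts as `ofRlfZWeak`). [cite: MochizukiEtTh2009, Def 3.6 p.77] -/
theorem eq_one_of_isNonCuspidal_of_isCuspidal_weakR
    (C : TemperedFrobenioid (RealifiedDivisorMonoids.ofRlfRWeak dm hpf) D VD) {A : Dᵒᵖ} (x : C.Φ.carrier A)
    (hn : C.IsNonCuspidal x) (hc : C.IsCuspidal x) : x = 1 := by
  have h1 : ((x : C.ΦRlog.obj A) : (hpf (C.baseOp A)).weak.Rlf) = 1 :=
    RealifiedDivisorMonoids.ofRlfZWeak_eq_one_of_mem_ncspR_of_mem_cspR dm hpf (C.baseOp A)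
      (RealifiedDivisorMonoids.ofRlfZWeak_disjoint_toRSuppOf dm hpf _) hn hc
  exact Subtype.ext h1

/-- `y ≼ x` in `Φ(A)` gives `y ∣ x^n` in `Φ^{ℝ-log}(A)` for some `n ≥ 1` (weak data).
[cite: MochizukiEtTh2009, Def 3.6 p.77] -/
theorem exists_dvd_pow_of_precsim_weakR
    (C : TemperedFrobenioid (RealifiedDivisorMonoids.ofRlfRWeak dm hpf) D VD) {A : Dᵒᵖ} {x y : C.Φ.carrier A} (h : Precsim y x) :
    ∃ n : ℕ, n ≠ 0 ∧ ((C.Φ.carrier A).subtype y : (hpf (C.baseOp A)).weak.Rlf) ∣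
      ((C.Φ.carrier A).subtype x : (hpf (C.baseOp A)).weak.Rlf) ^ n := by
  obtain ⟨n, hn, hyx⟩ := h
  refine ⟨n, hn.ne', ?_⟩
  rw [← map_pow]
  exact map_dvd _ hyx

/-- **(`hDn`, ⇒) Non-cuspidality descends along `≼`** over `ofRlfRWeak` (down- and root-closedness of
`Φ₀^ℝ(Y)^ncsp`). [cite: MochizukiEtTh2009, Def 3.6 p.77] -/
theorem isNonCuspidal_of_precsim_weakR
    (C : TemperedFrobenioid (RealifiedDivisorMonoids.ofRlfRWeak dm hpf) D VD) {A : Dᵒᵖ} {x y : C.Φ.carrier A} (hyx : Precsim y x)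
    (hx : C.IsNonCuspidal x) : C.IsNonCuspidal y := by
  obtain ⟨n, hn, hdvd⟩ := C.exists_dvd_pow_of_precsim_weakR hyx
  exact RealifiedDivisorMonoids.ofRlfZWeak_ncspR_of_dvd dm hpf _ hdvd
    ((RealifiedDivisorMonoids.ofRlfZWeak_pow_mem_ncspR_iff dm hpf _ _ hn).2 hx)

/-- **(`hDc`, ⇒) Cuspidality descends along `≼`** over `ofRlfRWeak`. [cite: MochizukiEtTh2009, Def 3.6 p.77] -/
theorem isCuspidal_of_precsim_weakR
    (C : TemperedFrobenioid (RealifiedDivisorMonoids.ofRlfRWeak dm hpf) D VD) {A : Dᵒᵖ} {x y : C.Φ.carrier A} (hyx : Precsim y x)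
    (hx : C.IsCuspidal x) : C.IsCuspidal y := by
  obtain ⟨n, hn, hdvd⟩ := C.exists_dvd_pow_of_precsim_weakR hyx
  exact RealifiedDivisorMonoids.ofRlfZWeak_cspR_of_dvd dm hpf _ hdvd
    ((RealifiedDivisorMonoids.ofRlfZWeak_pow_mem_cspR_iff dm hpf _ _ hn).2 hx)

/-- **(`hDn`) "`x` is non-cuspidal iff every primary `y ≼ x` of `Φ(A)` is"** — over `ofRlfRWeak`, from
the hypothesis (R3) "no phantom support": every prime in the support of `x` lies in the support of some
primary `y ≼ x` of `Φ(A)`. [cite: MochizukiEtTh2009, Def 3.6 p.77] -/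
theorem isNonCuspidal_iff_primaries_of_noPhantom_weakR
    (C : TemperedFrobenioid (RealifiedDivisorMonoids.ofRlfRWeak dm hpf) D VD) {A : Dᵒᵖ}
    (hR3 : ∀ (x : C.Φ.carrier A) (𝔮 : Primes (Perfection (dm.Φ₀.obj (C.baseOp A)))),
      𝔮 ∈ supp ((hpf (C.baseOp A)).weak.realification.subtype (x : C.ΦRlog.obj A)) →
        ∃ y : C.Φ.carrier A, IsPrimary y ∧ Precsim y x ∧
          𝔮 ∈ supp ((hpf (C.baseOp A)).weak.realification.subtype (y : C.ΦRlog.obj A)))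
    (x : C.Φ.carrier A) :
    C.IsNonCuspidal x ↔ ∀ y : C.Φ.carrier A, IsPrimary y → Precsim y x → C.IsNonCuspidal y := by
  refine ⟨fun hx y _ hyx => C.isNonCuspidal_of_precsim_weakR hyx hx, fun h => ?_⟩
  rw [isNonCuspidal_iff_supp_weakR]
  intro 𝔮 h𝔮
  obtain ⟨y, hy, hyx, hy𝔮⟩ := hR3 x 𝔮 h𝔮
  exact (C.isNonCuspidal_iff_supp_weakR y).1 (h y hy hyx) hy𝔮

/-- **(`hDc`) "`x` is cuspidal iff every primary `y ≼ x` of `Φ(A)` is"** — over `ofRlfRWeak`, from (R3).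
[cite: MochizukiEtTh2009, Def 3.6 p.77] -/
theorem isCuspidal_iff_primaries_of_noPhantom_weakR
    (C : TemperedFrobenioid (RealifiedDivisorMonoids.ofRlfRWeak dm hpf) D VD) {A : Dᵒᵖ}
    (hR3 : ∀ (x : C.Φ.carrier A) (𝔮 : Primes (Perfection (dm.Φ₀.obj (C.baseOp A)))),
      𝔮 ∈ supp ((hpf (C.baseOp A)).weak.realification.subtype (x : C.ΦRlog.obj A)) →
        ∃ y : C.Φ.carrier A, IsPrimary y ∧ Precsim y x ∧
          𝔮 ∈ supp ((hpf (C.baseOp A)).weak.realification.subtype (y : C.ΦRlog.obj A)))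
    (x : C.Φ.carrier A) :
    C.IsCuspidal x ↔ ∀ y : C.Φ.carrier A, IsPrimary y → Precsim y x → C.IsCuspidal y := by
  refine ⟨fun hx y _ hyx => C.isCuspidal_of_precsim_weakR hyx hx, fun h => ?_⟩
  rw [isCuspidal_iff_supp_weakR]
  intro 𝔮 h𝔮
  obtain ⟨y, hy, hyx, hy𝔮⟩ := hR3 x 𝔮 h𝔮
  exact (C.isCuspidal_iff_supp_weakR y).1 (h y hy hyx) hy𝔮

/-- **(R3) "no phantom support" DISCHARGED over `ofRlfRWeak` when `Φ(A)` has countably many primes** (the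
geometric case: special-fibre components indexed by `ℤ`, finitely many cusps): every prime of `Φ₀(Y_A)^pf`
in the support of `x ∈ Φ(A)` lies in the support of some primary `y ≼ x` of `Φ(A)` — this seat's
`IsPerfFactorialWeak.exists_isPrimary_precsim_mem_supp` (cofinality of `Φ(A)^pf` in `Φ(A)^rlf` is part of
`IsPerfFactorialCof`, Def. 3.6 (ii) over the weak vocabulary). [cite: MochizukiEtTh2009, Cor 3.8 p.82] -/
theorem noPhantom_of_countable_weakR
    (C : TemperedFrobenioid (RealifiedDivisorMonoids.ofRlfRWeak dm hpf) D VD) (A : Dᵒᵖ)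
    (hcnt : Countable (Primes (Perfection ↥(C.Φ.carrier A)))) (x : C.Φ.carrier A)
    (𝔮 : Primes (Perfection (dm.Φ₀.obj (C.baseOp A))))
    (h𝔮 : 𝔮 ∈ supp ((hpf (C.baseOp A)).weak.realification.subtype (x : C.ΦRlog.obj A))) :
    ∃ y : C.Φ.carrier A, IsPrimary y ∧ Precsim y x ∧
      𝔮 ∈ supp ((hpf (C.baseOp A)).weak.realification.subtype (y : C.ΦRlog.obj A)) :=
  (C.isPerfFactorial A).elim fun hw hcof =>
    @IsPerfFactorialWeak.exists_isPrimary_precsim_mem_supp _ _ (hpf (C.baseOp A)).weak (C.Φ.carrier A) hw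
      hcof hcnt x 𝔮 h𝔮

/-- **(`hD1`) base-field-theoretic divisors are non-cuspidal** over `ofRlfRWeak`, from the `Φ₀`-datum `hcn`
"divisors of constants are quotients of non-cuspidal log-divisors" — `ℝ·Φ₀^cnst` and `Φ₀^ℝ(Y)^ncsp` of `ofRlfRWeak`
are those of `ofRlfZWeak` (`ofRlfRWeak_cnstR`, `ofRlfRWeak_ncspR`), so this seat's `ofRlfZWeak_mem_ncspR_of_mem_cnstR`
applies verbatim. [cite: MochizukiEtTh2009, Def 3.6 p.78] -/
theorem isNonCuspidal_of_isBaseFieldTheoreticDiv_weakR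
    (C : TemperedFrobenioid (RealifiedDivisorMonoids.ofRlfRWeak dm hpf) D VD)
    (hcn : ∀ (A : Dᵒᵖ) (b : dm.B₀.obj (C.baseOp A)), b ∈ dm.F₀ (C.baseOp A) →
      ∃ n₁ n₂ : dm.Φ₀.obj (C.baseOp A), n₁ ∈ dm.ncsp₀ (C.baseOp A) ∧ n₂ ∈ dm.ncsp₀ (C.baseOp A) ∧
        dm.div₀ (C.baseOp A) b * Algebra.GrothendieckGroup.of n₂ = Algebra.GrothendieckGroup.of n₁)
    (A : Dᵒᵖ) (y : C.Φ.carrier A) (hy : C.IsBaseFieldTheoreticDiv y) : C.IsNonCuspidal y :=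
  RealifiedDivisorMonoids.ofRlfZWeak_mem_ncspR_of_mem_cnstR dm hpf (C.baseOp A) (hcn A) hy.2

end TemperedFrobenioid

/-! ### Cor. 3.8 (iii) (pre-steps) for tempered Frobenioids over `ofRlfRWeak` data -/

section Cor38WeakR

variable {D₀ : Type u₀} [Category.{v₀} D₀] {dm : DivisorMonoids.{u₀, v₀, w} D₀}
  {hpf : ∀ Y : D₀ᵒᵖ, IsPerfFactorialCof (dm.Φ₀.obj Y)}
  {D : Type u} [Category.{v} D] {VD : FrdICatStub.{u, v, w} D}
  {D₀' : Type u₀} [Category.{v₀} D₀'] {dm' : DivisorMonoids.{u₀, v₀, w} D₀'}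
  {hpf' : ∀ Y : D₀'ᵒᵖ, IsPerfFactorialCof (dm'.Φ₀.obj Y)}
  {D' : Type u} [Category.{v} D'] {VD' : FrdICatStub.{u, v, w} D'}


open TemperedFrobenioid

/-- **Cor. 3.8 (iii), pre-step clause, for tempered Frobenioids over the `ℝ`-realified data `ofRlfRWeak`**: the
data axioms `hDa`, `hDn`, `hDc` of `cor38_iii_of` are discharged (the last two from (R3)); remaining named
inputs: [FrdI] Thm. 3.4 (ii)/(iii) and Thm. 4.2 (i) for `Ψ^{±1}` (`hpre`…`hfrob'`), abc-iut-L2-t3's datum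
"base-field-theoretic ⇒ non-cuspidal" (`hD1`) and (R3) (`hR3`). [cite: MochizukiEtTh2009, Cor 3.8 p.81] -/
theorem cor38_iii_ofRlfRWeak
    {C₁ : TemperedFrobenioid (RealifiedDivisorMonoids.ofRlfRWeak dm hpf) D VD}
    {C₂ : TemperedFrobenioid (RealifiedDivisorMonoids.ofRlfRWeak dm' hpf') D' VD'} (h : Cor38Hyp C₁ C₂)
    (hpre : ∀ ⦃X Y : C₁.category⦄ (φ : X ⟶ Y),
      PreFrobenioid.IsPreStep C₁.toElem φ → PreFrobenioid.IsPreStep C₂.toElem (h.Ψ.functor.map φ))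
    (hpre' : ∀ ⦃X Y : C₂.category⦄ (φ : X ⟶ Y),
      PreFrobenioid.IsPreStep C₂.toElem φ → PreFrobenioid.IsPreStep C₁.toElem (h.Ψ.inverse.map φ))
    (hprim : ∀ ⦃X Y : C₁.category⦄ (φ : X ⟶ Y), PreFrobenioid.IsPrimaryPreStep C₁.toElem φ →
      PreFrobenioid.IsPrimaryPreStep C₂.toElem (h.Ψ.functor.map φ))
    (hprim' : ∀ ⦃X Y : C₂.category⦄ (φ : X ⟶ Y), PreFrobenioid.IsPrimaryPreStep C₂.toElem φ →
      PreFrobenioid.IsPrimaryPreStep C₁.toElem (h.Ψ.inverse.map φ))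
    (hfrob : ∀ ⦃X Y : C₁.category⦄ (φ : X ⟶ Y), PreFrobenioid.IsFrobeniusType C₁.toElem φ →
      PreFrobenioid.IsFrobeniusType C₂.toElem (h.Ψ.functor.map φ))
    (hfrob' : ∀ ⦃X Y : C₂.category⦄ (φ : X ⟶ Y), PreFrobenioid.IsFrobeniusType C₂.toElem φ →
      PreFrobenioid.IsFrobeniusType C₁.toElem (h.Ψ.inverse.map φ))
    (hD1₁ : ∀ (A : Dᵒᵖ) (y : C₁.Φ.carrier A), C₁.IsBaseFieldTheoreticDiv y → C₁.IsNonCuspidal y)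
    (hD1₂ : ∀ (A : D'ᵒᵖ) (y : C₂.Φ.carrier A), C₂.IsBaseFieldTheoreticDiv y → C₂.IsNonCuspidal y)
    (hR3₁ : ∀ (A : Dᵒᵖ) (x : C₁.Φ.carrier A) (𝔮 : Primes (Perfection (dm.Φ₀.obj (C₁.baseOp A)))),
      𝔮 ∈ supp ((hpf (C₁.baseOp A)).weak.realification.subtype (x : C₁.ΦRlog.obj A)) →
        ∃ y : C₁.Φ.carrier A, IsPrimary y ∧ Precsim y x ∧
          𝔮 ∈ supp ((hpf (C₁.baseOp A)).weak.realification.subtype (y : C₁.ΦRlog.obj A)))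
    (hR3₂ : ∀ (A : D'ᵒᵖ) (x : C₂.Φ.carrier A) (𝔮 : Primes (Perfection (dm'.Φ₀.obj (C₂.baseOp A)))),
      𝔮 ∈ supp ((hpf' (C₂.baseOp A)).weak.realification.subtype (x : C₂.ΦRlog.obj A)) →
        ∃ y : C₂.Φ.carrier A, IsPrimary y ∧ Precsim y x ∧
          𝔮 ∈ supp ((hpf' (C₂.baseOp A)).weak.realification.subtype (y : C₂.ΦRlog.obj A))) :
    Cor38_iii h :=
  cor38_iii_of_weak h hpre hpre' hprim hprim' hfrob hfrob'
    hD1₁ (fun _ x => C₁.eq_one_of_isNonCuspidal_of_isCuspidal_weakR x)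
    (fun A x => C₁.isNonCuspidal_iff_primaries_of_noPhantom_weakR (hR3₁ A) x)
    (fun A x => C₁.isCuspidal_iff_primaries_of_noPhantom_weakR (hR3₁ A) x)
    hD1₂ (fun _ x => C₂.eq_one_of_isNonCuspidal_of_isCuspidal_weakR x)
    (fun A x => C₂.isNonCuspidal_iff_primaries_of_noPhantom_weakR (hR3₂ A) x)
    (fun A x => C₂.isCuspidal_iff_primaries_of_noPhantom_weakR (hR3₂ A) x)

/-- **Cor. 3.8 (iii), pre-step clause, over `ofRlfRWeak` data, the [FrdI] rows DISCHARGED**: as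
`cor38_iii_ofRlfRWeak`, with [FrdI] Thm. 3.4 (ii)/(iii) (C38-L02a, from the tree's proved `FrdI.thm34ii_ofFunctor` over
`h.fsmff`), Thm. 3.7 (i)(ii) (C38-L01) and Thm. 4.2 (i) for weakly perf-factorial `Φ_i` (`hprim`/`hprim'`) supplied BY NAME
through `Cor38Hyp.cor38_iii_of_isFrobenioid_weak`.  Remaining inputs: `IsFrobenioid` ([FrdI] Thm. 5.2 (ii)), the datum
"base-field-theoretic ⇒ non-cuspidal" (`hD1`) and (R3) (`hR3`). [cite: MochizukiEtTh2009, Cor 3.8 p.81] -/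
theorem cor38_iii_ofRlfRWeak_of_isFrobenioid
    {C₁ : TemperedFrobenioid (RealifiedDivisorMonoids.ofRlfRWeak dm hpf) D VD}
    {C₂ : TemperedFrobenioid (RealifiedDivisorMonoids.ofRlfRWeak dm' hpf') D' VD'} (h : Cor38Hyp C₁ C₂)
    (hF₁ : PreFrobenioid.IsFrobenioid C₁.toElem) (hF₂ : PreFrobenioid.IsFrobenioid C₂.toElem)
    (hD1₁ : ∀ (A : Dᵒᵖ) (y : C₁.Φ.carrier A), C₁.IsBaseFieldTheoreticDiv y → C₁.IsNonCuspidal y)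
    (hD1₂ : ∀ (A : D'ᵒᵖ) (y : C₂.Φ.carrier A), C₂.IsBaseFieldTheoreticDiv y → C₂.IsNonCuspidal y)
    (hR3₁ : ∀ (A : Dᵒᵖ) (x : C₁.Φ.carrier A) (𝔮 : Primes (Perfection (dm.Φ₀.obj (C₁.baseOp A)))),
      𝔮 ∈ supp ((hpf (C₁.baseOp A)).weak.realification.subtype (x : C₁.ΦRlog.obj A)) →
        ∃ y : C₁.Φ.carrier A, IsPrimary y ∧ Precsim y x ∧
          𝔮 ∈ supp ((hpf (C₁.baseOp A)).weak.realification.subtype (y : C₁.ΦRlog.obj A)))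
    (hR3₂ : ∀ (A : D'ᵒᵖ) (x : C₂.Φ.carrier A) (𝔮 : Primes (Perfection (dm'.Φ₀.obj (C₂.baseOp A)))),
      𝔮 ∈ supp ((hpf' (C₂.baseOp A)).weak.realification.subtype (x : C₂.ΦRlog.obj A)) →
        ∃ y : C₂.Φ.carrier A, IsPrimary y ∧ Precsim y x ∧
          𝔮 ∈ supp ((hpf' (C₂.baseOp A)).weak.realification.subtype (y : C₂.ΦRlog.obj A))) :
    Cor38_iii h :=
  h.cor38_iii_of_isFrobenioid_weak hF₁ hF₂
    hD1₁ (fun _ x => C₁.eq_one_of_isNonCuspidal_of_isCuspidal_weakR x)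
    (fun A x => C₁.isNonCuspidal_iff_primaries_of_noPhantom_weakR (hR3₁ A) x)
    (fun A x => C₁.isCuspidal_iff_primaries_of_noPhantom_weakR (hR3₁ A) x)
    hD1₂ (fun _ x => C₂.eq_one_of_isNonCuspidal_of_isCuspidal_weakR x)
    (fun A x => C₂.isNonCuspidal_iff_primaries_of_noPhantom_weakR (hR3₂ A) x)
    (fun A x => C₂.isCuspidal_iff_primaries_of_noPhantom_weakR (hR3₂ A) x)

/-- **Cor. 3.8 (iii), pre-step clause, over `ofRlfRWeak`, the [FrdI] rows discharged and (R3) DISCHARGED for countably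
many primes** (`noPhantom_of_countable_weakR`).  Remaining inputs: `IsFrobenioid`, countability of the primes of the
`Φ_i(A)`, and the datum "base-field-theoretic ⇒ non-cuspidal" (`hD1`). [cite: MochizukiEtTh2009, Cor 3.8 p.81] -/
theorem cor38_iii_ofRlfRWeak_of_isFrobenioid_of_countable
    {C₁ : TemperedFrobenioid (RealifiedDivisorMonoids.ofRlfRWeak dm hpf) D VD}
    {C₂ : TemperedFrobenioid (RealifiedDivisorMonoids.ofRlfRWeak dm' hpf') D' VD'} (h : Cor38Hyp C₁ C₂)
    (hcnt₁ : ∀ A : Dᵒᵖ, Countable (Primes (Perfection ↥(C₁.Φ.carrier A))))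
    (hcnt₂ : ∀ A : D'ᵒᵖ, Countable (Primes (Perfection ↥(C₂.Φ.carrier A))))
    (hF₁ : PreFrobenioid.IsFrobenioid C₁.toElem) (hF₂ : PreFrobenioid.IsFrobenioid C₂.toElem)
    (hD1₁ : ∀ (A : Dᵒᵖ) (y : C₁.Φ.carrier A), C₁.IsBaseFieldTheoreticDiv y → C₁.IsNonCuspidal y)
    (hD1₂ : ∀ (A : D'ᵒᵖ) (y : C₂.Φ.carrier A), C₂.IsBaseFieldTheoreticDiv y → C₂.IsNonCuspidal y) :
    Cor38_iii h :=
  cor38_iii_ofRlfRWeak_of_isFrobenioid h hF₁ hF₂ hD1₁ hD1₂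
    (fun A x 𝔮 h𝔮 => C₁.noPhantom_of_countable_weakR A (hcnt₁ A) x 𝔮 h𝔮)
    (fun A x 𝔮 h𝔮 => C₂.noPhantom_of_countable_weakR A (hcnt₂ A) x 𝔮 h𝔮)

/-- **Cor. 3.8 (iii), pre-step clause, over the weak ℝ-realified data `ofRlfRWeak` — EVERY row of the printed proof and
every §3-internal input discharged or reduced to base data**: [FrdI] Thm. 3.4 (ii)/(iii), Thm. 3.7 (i)(ii), Thm. 4.2 (i)
(weakly perf-factorial `Φ_i`) by name; (R3) by countability of the primes (`NoPhantomSupport`); `hD1` by the `Φ₀`-level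
datum `hcn` "divisors of constants are quotients of non-cuspidal log-divisors" (Def. 3.1 (ii); `Sec3BsFldNcspWeak`).
Remaining named inputs: `IsFrobenioid` ([FrdI] Thm. 5.2 (ii)), `hcnt` (GAP-LEDGER G-L2d2-4), `hcn` (G-L2d2-3).
[cite: MochizukiEtTh2009, Cor 3.8 p.81] -/
theorem cor38_iii_ofRlfRWeak_of_isFrobenioid_of_countable_of_cnst
    {C₁ : TemperedFrobenioid (RealifiedDivisorMonoids.ofRlfRWeak dm hpf) D VD}
    {C₂ : TemperedFrobenioid (RealifiedDivisorMonoids.ofRlfRWeak dm' hpf') D' VD'} (h : Cor38Hyp C₁ C₂)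
    (hcnt₁ : ∀ A : Dᵒᵖ, Countable (Primes (Perfection ↥(C₁.Φ.carrier A))))
    (hcnt₂ : ∀ A : D'ᵒᵖ, Countable (Primes (Perfection ↥(C₂.Φ.carrier A))))
    (hcn₁ : ∀ (A : Dᵒᵖ) (b : dm.B₀.obj (C₁.baseOp A)), b ∈ dm.F₀ (C₁.baseOp A) →
      ∃ n₁ n₂ : dm.Φ₀.obj (C₁.baseOp A), n₁ ∈ dm.ncsp₀ (C₁.baseOp A) ∧ n₂ ∈ dm.ncsp₀ (C₁.baseOp A) ∧
        dm.div₀ (C₁.baseOp A) b * Algebra.GrothendieckGroup.of n₂ = Algebra.GrothendieckGroup.of n₁)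
    (hcn₂ : ∀ (A : D'ᵒᵖ) (b : dm'.B₀.obj (C₂.baseOp A)), b ∈ dm'.F₀ (C₂.baseOp A) →
      ∃ n₁ n₂ : dm'.Φ₀.obj (C₂.baseOp A), n₁ ∈ dm'.ncsp₀ (C₂.baseOp A) ∧ n₂ ∈ dm'.ncsp₀ (C₂.baseOp A) ∧
        dm'.div₀ (C₂.baseOp A) b * Algebra.GrothendieckGroup.of n₂ = Algebra.GrothendieckGroup.of n₁)
    (hF₁ : PreFrobenioid.IsFrobenioid C₁.toElem) (hF₂ : PreFrobenioid.IsFrobenioid C₂.toElem) :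
    Cor38_iii h :=
  cor38_iii_ofRlfRWeak_of_isFrobenioid_of_countable h hcnt₁ hcnt₂ hF₁ hF₂
    (C₁.isNonCuspidal_of_isBaseFieldTheoreticDiv_weakR hcn₁)
    (C₂.isNonCuspidal_of_isBaseFieldTheoreticDiv_weakR hcn₂)

/-- **Cor. 3.8 (iii), pre-step clause, over the weak ℝ-realified data `ofRlfRWeak`, the `Φ₀`-datum read from abc-iut-L2-t3's
[EtTh] Prop. 3.4 (ii) predicate bundle `DivisorMonoids.Prop34Const`** ("`div₀(c) = v_L(c) · div(ϖ_L)`" with `div(ϖ_L)`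
non-cuspidal — `Prop34Const.hcn` gives exactly the binder `hcn` of `cor38_iii_ofRlfRWeak_of_isFrobenioid_of_countable_of_cnst`;
GAP-LEDGER disposition D-G-L2d2-3).  Remaining named inputs: `IsFrobenioid` ([FrdI] Thm. 5.2 (ii)), `hcnt` (G-L2d2-4),
`hC_i : dm_i.Prop34Const`. [cite: MochizukiEtTh2009, Cor 3.8 p.81] -/
theorem cor38_iii_ofRlfRWeak_of_isFrobenioid_of_countable_of_prop34Const
    {C₁ : TemperedFrobenioid (RealifiedDivisorMonoids.ofRlfRWeak dm hpf) D VD}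
    {C₂ : TemperedFrobenioid (RealifiedDivisorMonoids.ofRlfRWeak dm' hpf') D' VD'} (h : Cor38Hyp C₁ C₂)
    (hcnt₁ : ∀ A : Dᵒᵖ, Countable (Primes (Perfection ↥(C₁.Φ.carrier A))))
    (hcnt₂ : ∀ A : D'ᵒᵖ, Countable (Primes (Perfection ↥(C₂.Φ.carrier A))))
    (hC₁ : dm.Prop34Const) (hC₂ : dm'.Prop34Const)
    (hF₁ : PreFrobenioid.IsFrobenioid C₁.toElem) (hF₂ : PreFrobenioid.IsFrobenioid C₂.toElem) :
    Cor38_iii h :=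
  cor38_iii_ofRlfRWeak_of_isFrobenioid_of_countable_of_cnst h hcnt₁ hcnt₂
    (fun A b hb => hC₁.hcn (C₁.baseOp A) b hb) (fun A b hb => hC₂.hcn (C₂.baseOp A) b hb) hF₁ hF₂

end Cor38WeakR

end Literature.AnabelianGeometry.EtaleTheta
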